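import Summits.BirchSwinnertonDyer.BirchSwinnertonDyer.Theorems.RamifiedSevenEllipticUnitsFrameDataOfGZK
import Summits.BirchSwinnertonDyer.Rank1Residual.X11b.AnticyclotomicEmbedding
import Literature.NumberTheory.EllipticCurves.BSDQuadraticDescentTorsionOddPartProofs
import Literature.NumberTheory.EllipticCurves.ArtinFormalismQuadraticLocalProofs
import Literature.NumberTheory.EllipticCurves.LocalRestrictionDegree
import Literature.NumberTheory.EllipticCurves.QuadraticTwistPadicReduction
import Literature.NumberTheory.EllipticCurves.VariableChangePointsMap
import Mathlib.NumberTheory.Padics.HeightOneSpectrum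
import HarnessLib

set_option linter.dupNamespace false
set_option autoImplicit false

/-!
# Route `RamifiedSevenEllipticUnits` (rung K7r), crux `StrictControlSeven` (stmt-BirchSwinnertonDyer-19145):
# the local input AT the ramified prime — `E(K_𝔭)[7] = 0` for every `W ∈ 𝒞₇`, `K_𝔭 = ℚ₇(√−7)`
# (BKNO (3.16) at the bottom layer, PROVED by quadratic descent of torsion to `ℚ₇`)

Cell `bsd-cm`, seat `bsd-cm-k7r-c4` (g0). HONEST FRAMING: nothing here closes the crux; BSD is not
proved by any of this. This file DISCHARGES the hypothesis `E(K_𝔭)[p] = 0` of the seat's exact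
control theorem (`RamifiedSevenEllipticUnitsStrictControlExactControl`, `strictControl_frame_natCard_eq`)
for the class 𝒞₇ at `p = 7`.

## The argument

Let `W ∈ 𝒞₇` be globally minimal with an O11 frame `(K, 𝔭, W', C)` at `7`: `K = ℚ(√−7)` is the CM
field, `𝔭 ∋ 7`, `W' = C • W^{(−7)}`. The completion `L = K_𝔭` is the quadratic extension
`F(√−7)` of `F = ℚ_7` (degree `≤ [K:ℚ] = 2` by `finrank_adicCompletion_le_of_liesOver`, and `√−7 ∉ ℚ_7`
since `‖y‖² = 7⁻¹` has no solution — `not_sq_eq_neg_seven_padic`). By the eigenspace decomposition of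
the Mordell–Weil group under `Gal(L/F)` away from `2` (tree
`card_primaryComponent_point_baseChange_quadratic_of_odd'`, Silverman *AEC* Exercise 10.16):
`#E(L)[7^∞] = #W(ℚ_7)[7^∞] · #W'(ℚ_7)[7^∞]`, and both factors are `1` by Mazur's local step for the
CM-by-`√−7` class (`seven_nsmul_eq_zero_padic`, bsd-cm-ram g5: the exceptional locus `v₇(c₆) = 1` is
empty; `W'` is again globally minimal with CM field `ℚ(√−7)`, `isIsogenous_of_isFrame`,
`X12.hasCM_of_isIsogenous`, `X12.cmFieldDiscrOfJ_eq_of_isIsogenous`). Hence `E(K_𝔭)[7^∞] = 0`.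

* `natCard_primaryComponent_eq_one_iff` — `#A[p^∞] = 1 ↔` no element of order `p` (bookkeeping);
* `not_sq_eq_neg_seven_padic` — `y² ≠ −7` in `ℚ_7`;
* **`noSevenTorsion_adicCompletion_of_classCSeven`** — for `W ∈ 𝒞₇` and a frame `(K, 𝔭, W', C)`
  at `7`: every point of `W_K(K_𝔭)` killed by `7` is `O`. This is the hypothesis `h𝔭` of
  `strictControl_frame_natCard_eq` at `p = 7` — BKNO's (3.16) `H⁰(K^ac_{∞,𝔭}, E[7^∞]) = 0` follows
  by pro-`7` descent (`fixedPoints_decomp_inf_kerSubgroup_eq_bot_of_noPTorsion`).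

References: [SilvermanAEC2009] Exercise 10.16, VII.3 Prop. 3.1; [Mazur1977] Ch. III §5 Step 1
(p. 158); [BurungaleKobayashiNakamuraOta2026] (3.16) (arXiv:2608.06879; statement only — proved here
for the class 𝒞₇).
-/

noncomputable section

open scoped Classical

open WeierstrassCurve NumberField IsDedekindDomain Field
  Literature.NumberTheory.EllipticCurves
  Literature.NumberTheory.EllipticCurves.Rank1Residual
  Literature.NumberTheory.GaloisRepresentations
  Summit.BirchSwinnertonDyer.Rank1Residual
  Summit.BirchSwinnertonDyer.Rank1Residual.X11b

namespace Summit.BirchSwinnertonDyer.BirchSwinnertonDyer.Theorems.RamifiedSevenEllipticUnits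

/-! ## §1 Bookkeeping: `#A[p^∞] = 1 ↔ A` has no point of order `p` -/

/-- For an abelian group `A` and a prime `p`: the `p`-primary component has exactly one element iff
no non-zero element of `A` is killed by `p` (`Nat.card`: an infinite `p`-primary component has
`Nat.card = 0 ≠ 1`). [folklore] -/
theorem natCard_primaryComponent_eq_one_iff {A : Type*} [AddCommGroup A] (p : ℕ) [Fact p.Prime] :
    Nat.card (AddCommGroup.primaryComponent A p) = 1 ↔ ∀ R : A, p • R = 0 → R = 0 := by
  constructor
  · intro h R hR
    have hmem : R ∈ AddCommGroup.primaryComponent A p :=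
      (AddCommGroup.mem_primaryComponent).mpr ⟨1, by rw [pow_one]; exact hR⟩
    rw [AddSubgroup.eq_bot_of_card_eq _ h, AddSubgroup.mem_bot] at hmem
    exact hmem
  · intro h
    have hbot : AddCommGroup.primaryComponent A p = ⊥ := by
      rw [eq_bot_iff]
      intro g hg
      obtain ⟨k, hk⟩ := (AddCommGroup.mem_primaryComponent).mp hg
      rw [AddSubgroup.mem_bot]
      clear hg
      induction k generalizing g with
      | zero => rwa [pow_zero, one_smul] at hk
      | succ k ih =>
        rw [pow_succ, mul_nsmul] at hk
        exact ih (h _ hk)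
    rw [hbot, AddSubgroup.card_bot]

/-! ## §2 `√−7 ∉ ℚ_7` -/

/-- **`−7` is not a square in `ℚ_7`**: `‖y‖² = ‖−7‖ = 7⁻¹` forces `7^{−2v(y)} = 7^{−1}`, impossible.
[folklore] -/
theorem not_sq_eq_neg_seven_padic (y : ℚ_[7]) : y ^ 2 ≠ -7 := by
  haveI : Fact (Nat.Prime 7) := ⟨by norm_num⟩
  intro h
  have hy0 : y ≠ 0 := by
    rintro rfl
    norm_num at h
  have h1 : ‖y‖ ^ 2 = (7 : ℝ)⁻¹ := by
    rw [← norm_pow, h, norm_neg]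
    have : ((7 : ℕ) : ℚ_[7]) = 7 := by norm_num
    rw [← this, Padic.norm_p]
    norm_num
  rw [Padic.norm_eq_zpow_neg_valuation hy0, ← zpow_natCast, ← zpow_mul, ← zpow_neg_one] at h1
  have hinj := zpow_right_injective₀ (G₀ := ℝ) (a := ((7 : ℕ) : ℝ)) (by norm_num) (by norm_num) h1
  omega

/-! ## §3 `E(K_𝔭)[7] = 0` on 𝒞₇ -/

/-- Transport of "no `p`-torsion" along a `ℚ`-algebra map `F → F'` for a curve over `ℚ` (points map
injectively, `Affine.Point.map_injective`). [cite: SilvermanAEC2009, VII.§1] -/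
theorem noPTorsion_baseChange_of_algHom (W : WeierstrassCurve ℚ) (p : ℕ) {F F' : Type}
    [Field F] [Algebra ℚ F] [Field F'] [Algebra ℚ F'] (e : F →ₐ[ℚ] F')
    (h : ∀ P : (W.baseChange F').toAffine.Point, p • P = 0 → P = 0) :
    ∀ R : (W.baseChange F).toAffine.Point, p • R = 0 → R = 0 := by
  intro R hR
  have hmap := h (WeierstrassCurve.Affine.Point.map e R) (by rw [← map_nsmul, hR, map_zero])
  exact WeierstrassCurve.Affine.Point.map_injective (W' := W) e (by rw [hmap, map_zero])

/-- **`E(K_𝔭)[7] = 0` for every `W ∈ 𝒞₇` at the ramified prime** (`K = ℚ(√−7)` the CM field,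
`𝔭 ∋ 7`, `W_K = W ⊗ K`): no `K_𝔭`-point of `W_K` of order `7`. Quadratic descent of `7`-primary
torsion along `K_𝔭 = ℚ_7(√−7)` to `W(ℚ_7)[7^∞]` and `W'(ℚ_7)[7^∞]` (`W' = C • W^{(−7)}` the frame
twin), both trivial by Mazur's local step on the CM-by-`√−7` class. This is BKNO's (3.16) read at
the bottom layer, as a theorem for 𝒞₇.
[cite: SilvermanAEC2009, Exercise 10.16] [cite: Mazur1977, Ch. III §5 Step 1 (p. 158)] [cite: BurungaleKobayashiNakamuraOta2026, (3.16) (arXiv:2608.06879; statement proved here for 𝒞₇)] -/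
theorem noSevenTorsion_adicCompletion_of_classCSeven (W : WeierstrassCurve ℚ) [W.IsElliptic]
    [W.IsGloballyMinimal] [Fact (Nat.Prime 7)] (hC : X12.ClassCSeven W)
    {K : Type} [Field K] [NumberField K] {𝔭 : HeightOneSpectrum (𝓞 K)}
    {W' : WeierstrassCurve ℚ} [W'.IsElliptic] [W'.IsGloballyMinimal] {C : VariableChange ℚ}
    (hF : X12.O11.IsFrame W 7 K 𝔭 W' C) :
    ∀ R : ((W.baseChange K).baseChange (𝔭.adicCompletion K)).toAffine.Point, 7 • R = 0 → R = 0 := by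
  have hCM : W.HasCM := hF.1
  have hK : IsImaginaryQuadratic K := hF.2.2.2.1
  have hdisc : NumberField.discr K = cmFieldDiscrOfJ W.j := hF.2.2.2.2.1
  have h𝔭 : ((7 : ℕ) : 𝓞 K) ∈ 𝔭.asIdeal := hF.2.2.2.2.2.1
  have hW' : C • W.quadraticTwist ((cmFieldDiscrOfJ W.j : ℤ) : ℚ) = W' := hF.2.2.2.2.2.2
  have hj : cmFieldDiscrOfJ W.j = -7 := hC.2.1
  -- no `7`-torsion over `ℚ_7` for `W` and for the twin `W'`
  have hiso : IsIsogenous W W' := isIsogenous_of_isFrame hF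
  have hCM' : W'.HasCM := X12.hasCM_of_isIsogenous hiso hCM
  have hj' : cmFieldDiscrOfJ W'.j = -7 := by
    rw [← X12.cmFieldDiscrOfJ_eq_of_isIsogenous hiso hCM, hj]
  have h7W := seven_nsmul_eq_zero_padic W hCM hj
  have h7W' := seven_nsmul_eq_zero_padic W' hCM' hj'
  -- the local fields `F = ℚ_7` (completion of `ℚ` at `7`) and `L = K_𝔭`
  haveI : 𝔭.asIdeal.LiesOver (ratPlace 7).asIdeal := ⟨by rw [← under_eq_ratPlace_of_mem h𝔭]; rfl⟩
  set F : Type := (ratPlace 7).adicCompletion ℚ with hFdef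
  set L : Type := 𝔭.adicCompletion K with hLdef
  haveI : CharZero F := charZero_of_injective_algebraMap (algebraMap ℚ F).injective
  haveI : CharZero L := charZero_of_injective_algebraMap (algebraMap K L).injective
  letI : Algebra F L := (adicCompletionMap (K := ℚ) K (ratPlace 7) 𝔭).toAlgebra
  obtain ⟨hfin, hle⟩ := finrank_adicCompletion_le_of_liesOver (K := ℚ) K (ratPlace 7) 𝔭
  haveI : FiniteDimensional F L := hfin
  rw [hK.1] at hle
  -- `F ≃ ℚ_7` and the transports of "no 7-torsion" to `F`
  let e₇ : F →+* ℚ_[7] :=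
    (Padic.adicCompletionEquiv (𝓞 ℚ) ⟨7, Fact.out⟩).symm.toAlgEquiv.toRingEquiv.toRingHom
  have h7F : ∀ R : (W.baseChange F).toAffine.Point, 7 • R = 0 → R = 0 :=
    noPTorsion_baseChange_of_algHom W 7 e₇.toRatAlgHom h7W
  have h7F' : ∀ R : (W'.baseChange F).toAffine.Point, 7 • R = 0 → R = 0 :=
    noPTorsion_baseChange_of_algHom W' 7 e₇.toRatAlgHom h7W'
  -- `√−7 ∈ L`, not in `F`
  obtain ⟨θ₁, -, hθ₁sq⟩ := exists_sq_eq_discr_not_mem_range K hK.1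
  rw [hdisc, hj] at hθ₁sq
  simp only [Int.cast_neg, Int.cast_ofNat, map_neg, map_ofNat] at hθ₁sq
  set θ : L := algebraMap K L θ₁ with hθdef
  have hθsq : θ ^ 2 = algebraMap F L (-7) := by
    rw [map_neg, map_ofNat, hθdef, ← map_pow, hθ₁sq, map_neg, map_ofNat]
  have hθ : θ ∉ Set.range (algebraMap F L) := by
    rintro ⟨x, hx⟩
    have hx2 : x ^ 2 = -7 := (algebraMap F L).injective (by rw [map_pow, hx, hθsq, map_neg, map_ofNat])
    apply not_sq_eq_neg_seven_padic (e₇ x)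
    rw [← map_pow, hx2, map_neg, map_ofNat]
  -- `[L : F] = 2`
  have h2 : Module.finrank F L = 2 := by
    have hle' : Module.finrank F L ≤ 2 := hle
    have hpos : 0 < Module.finrank F L := Module.finrank_pos
    have hne1 : Module.finrank F L ≠ 1 := by
      intro h1
      have hbot : (⊥ : Subalgebra F L) = ⊤ := Subalgebra.bot_eq_top_iff_finrank_eq_one.mpr h1
      apply hθ
      have hmem : θ ∈ (⊥ : Subalgebra F L) := by rw [hbot]; exact Algebra.mem_top
      rwa [Algebra.mem_bot] at hmem
    omega
  -- the quadratic descent of `7`-primary torsion: `#E(L)[7^∞] = #W(F)[7^∞] · #W'(F)[7^∞]`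
  have hWd : ∃ D : VariableChange F,
      D • (W.baseChange F).quadraticTwist (-7) = W'.baseChange F := by
    refine ⟨C.map (algebraMap ℚ F), ?_⟩
    rw [hj] at hW'
    simp only [Int.cast_neg, Int.cast_ofNat] at hW'
    have h7 : (-7 : F) = algebraMap ℚ F (-7) := by rw [map_neg, map_ofNat]
    rw [h7, baseChange, baseChange, ← map_quadraticTwist, map_variableChange, hW']
  have hKL : (W.baseChange K).baseChange L = W.baseChange L :=
    W.map_baseChange (algebraMap K L).toRatAlgHom
  have hFL : (W.baseChange F).baseChange L = W.baseChange L :=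
    W.map_baseChange (algebraMap F L).toRatAlgHom
  have hmodel : ∃ D : VariableChange L,
      D • (W.baseChange F).baseChange L = (W.baseChange K).baseChange L :=
    ⟨1, by rw [one_smul, hFL, hKL]⟩
  have key := card_primaryComponent_point_baseChange_quadratic_of_odd' (W.baseChange F) h2 hθ hθsq
    hWd hmodel 7 (by norm_num)
  rw [(natCard_primaryComponent_eq_one_iff 7).mpr h7F,
    (natCard_primaryComponent_eq_one_iff 7).mpr h7F', mul_one] at key
  exact (natCard_primaryComponent_eq_one_iff 7).mp key

end Summit.BirchSwinnertonDyer.BirchSwinnertonDyer.Theorems.RamifiedSevenEllipticUnits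

end
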